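import Literature.AlgebraicGeometry.GroupSchemes.BarsottiTateGroupTorsionLayers
import Literature.NumberTheory.EllipticCurves.NeronModelExtensionLocal
import HarnessLib

/-!
# The TRANSLATION COVER: a point of a Barsotti–Tate layer lifts along a square-zero thickening LOCALLY for a finite flat surjective cover,
# granted lifting for the unit components ([Tate1967] §2.4; [Katz1981SerreTate] §1.1; the «(s2) spine» of formal smoothness)

Topic `Literature/AlgebraicGeometry/GroupSchemes`; namespace `Literature.AlgebraicGeometry.GroupSchemes.BTGroup`.  THEOREMS ONLY (no definition,
no named fact, no instance, no notation, no `sorry`).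

THE PRINT.  [Messing1972] II (3.3.13) «a Barsotti–Tate group over a base on which `p` is nilpotent is formally smooth»; [Tate1967] §2.4: a point
of a `p`-divisible group lifts along nilpotent thickenings by lifting in the formal group `Ĝ = lim 𝒪(G[pⁿ]⁰)` AFTER TRANSLATING it into the unit
component.  Over a non-local test scheme the translation needs a root of the point, which exists only after the FINITE FLAT base change
`W := T ×_S G[pⁿ] → T` (tautological point `τ`): on `W₀` the point `u₀ · τ₀⁻¹` is defined, the locus `V ⊆ W` where it lies in the unit component
`G[pⁿ]⁰` is OPEN AND CLOSED (the thickening `W₀ ↪ W` is a homeomorphism), `V → T` is finite, flat and SURJECTIVE (the section `(𝟙, u₀)` of `W₀ → T₀`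
lands in `V₀`), and on `V` the translated point lifts by the unit-component lifting, whence a lift of `u₀ ∣_{V₀}` after translating back by `τ`.
This is the LOCAL half of the fpqc proof of (3.3.13) for deformations of `X₀[p^∞]` (cell `hodgecm-mathlib`, P6b σ2, E2a «(s2) road»: the global
half — `F^p` is independent of the local lift and glues, ★ `ReductionKernelKilledByNSquare` + ★ `FpqcDescentOfMorphisms` — is the consumer's).

STATEMENT (`exists_finiteFlat_cover_lift`).  `A` a commutative ring, `J ⊆ A` an ideal (the thickening `i : Spec (A⧸J) ↪ Spec A`; no hypothesis on
`J` is needed for the construction — nilpotence enters only through `hlift`), `B` a Barsotti–Tate group over `Spec A` (★ `BTGroup`), and for every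
layer an open-and-closed immersion `j n : G₀ n ⟶ B.G n` THROUGH WHICH THE UNIT SECTION FACTORS (the unit components, ★
`UnitComponentOfFiniteGroupScheme.exists_unitComponent` over a henselian local base) satisfying the HYPOTHESIS `hlift`: points of `G₀ n` with values
in the reduction `V₀ = V ×_{Spec A} Spec (A⧸J)` of an AFFINE `Spec A`-scheme `V` lift to `V`-points of some `G₀ m`, `m ≥ n`, compatibly with the
transitions (the `Spec`∕`Γ` form of ★ `AdicTopology.ChevalleyTowerLift.exists_algHom_lift_of_iInf_ker_eq_bot`).  THEN for every AFFINE `T` over `Spec A`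
with cartesian reduction `(ρ : T₀ → T, b : T₀ → Spec (A⧸J))` and every point `u₀ : T₀ ⟶ B.G n` over `Spec A` there are an affine `V` over `Spec A`, a
morphism `c : V ⟶ T` over `Spec A` which is FINITE, FLAT and SURJECTIVE, `m ≥ n` and a point `F : V ⟶ B.G m` with
`pullback.fst c ρ ≫ F = pullback.snd c ρ ≫ u₀ ≫ transition` — «`u₀` lifts on the cover `V`».

Written for cell `hodgecm-mathlib` (P6b σ2 E2a, LEAD ruling W1′: the (s2) road; consumer = the (s2) assembly `PowerLiftFpqcDescent`); HC_CM is proved only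
modulo the 7 printed citations until rung 0 closes; nothing here is about HC.

## References
* [Tate1967] J. T. Tate, *p-divisible groups*, Proc. Conf. Local Fields (Driebergen 1966), Springer (1967), §2.2, §2.4.
* [Katz1981SerreTate] N. Katz, *Serre–Tate local moduli*, LNM 868 (1981), §1.1 (Lemma 1.1.3 (3): «any lifting»).
* [Messing1972] W. Messing, *The Crystals Associated to Barsotti–Tate Groups*, LNM 264 (1972), Ch. II Thm. (3.3.13).
-/

noncomputable section

universe u

open CategoryTheory CategoryTheory.Limits AlgebraicGeometry MonoidalCategory CartesianMonoidalCategory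
open scoped MonObj

namespace Literature.AlgebraicGeometry.GroupSchemes

/-! ## §1 Topology: a clopen subset transported along a surjective closed immersion -/

/-- Along a SURJECTIVE CLOSED IMMERSION `f : X → Y` (e.g. a base change of a nilpotent thickening) a clopen subset `U ⊆ X` has CLOPEN image,
and `f⁻¹(f U) = U`. [cite: Tate1967, §2.4] -/
theorem isClopen_image_of_isClosedImmersion_of_surjective {X Y : Scheme.{u}} (f : X ⟶ Y) [IsClosedImmersion f] [Surjective f]
    {U : Set X} (hU : IsClopen U) : IsClopen (f.base '' U) ∧ f.base ⁻¹' (f.base '' U) = U := by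
  have hinj : Function.Injective f.base := f.isClosedEmbedding.injective
  have hbij : Function.Bijective f.base := ⟨hinj, f.surjective⟩
  have hcl : IsClosed (f.base '' U) := f.isClosedEmbedding.isClosedMap _ hU.1
  have hop : IsOpen (f.base '' U) := by
    rw [← isClosed_compl_iff, ← Set.image_compl_eq hbij]
    exact f.isClosedEmbedding.isClosedMap _ hU.compl.1
  exact ⟨⟨hcl, hop⟩, Set.preimage_image_eq U hinj⟩

/-- `Spec (A⧸J) → Spec A` is SURJECTIVE when `J` consists of nilpotents (its image is `V(J) = Spec A`). [cite: Tate1967, §2.4] -/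
theorem surjective_specMap_quotient_mk_of_subset_nilradical {A : Type u} [CommRing A] (J : Ideal A)
    (hJ : (J : Set A) ⊆ nilradical A) : Surjective (Spec.map (CommRingCat.ofHom (Ideal.Quotient.mk J))) := by
  refine ⟨fun x => ?_⟩
  have hx : x ∈ Set.range (PrimeSpectrum.comap (Ideal.Quotient.mk J)) := by
    rw [range_comap_of_surjective _ _ Ideal.Quotient.mk_surjective, Ideal.mk_ker,
      (PrimeSpectrum.zeroLocus_eq_univ_iff _).mpr hJ]
    trivial
  obtain ⟨y, hy⟩ := hx
  exact ⟨y, hy⟩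

/-! ## §2 The translation cover -/

namespace BTGroup

variable {A : Type u} [CommRing A] (J : Ideal A) {p h : ℕ} (B : BTGroup (Spec (.of A)) p h)

/-- **THE TRANSLATION COVER** ([Tate1967] §2.4; [Katz1981SerreTate] §1.1): see the module docstring.  `A` any commutative ring, `J ⊆ A` any ideal
(`i : Spec (A⧸J) ↪ Spec A`), `B` a Barsotti–Tate group over `Spec A`, `j n : G₀ n ⟶ B.G n` open-and-closed immersions through which the unit sections
factor, `hlift` = lifting of points of the `G₀ n` along the `J`-thickenings of AFFINE `Spec A`-schemes, up the tower.  For an affine `T` over `Spec A`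
with CARTESIAN reduction square `(ρ, b)` over `i` and a point `u₀ : T₀ ⟶ B.G n` over `Spec A`: there are an affine `V`, a FINITE FLAT SURJECTIVE
`c : V ⟶ T` over `Spec A`, `m ≥ n` and `F : V ⟶ B.G m` with `pullback.fst c.left ρ ≫ F.left = pullback.snd c.left ρ ≫ u₀ ≫ (B.transition hnm).left`.
[cite: Tate1967, §2.4] [cite: Katz1981SerreTate, §1.1 Lemma 1.1.3 (3)] [cite: Messing1972, Ch. II Thm. (3.3.13)] -/
theorem exists_finiteFlat_cover_lift (hJ : (J : Set A) ⊆ nilradical A)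
    (G₀ : ℕ → Over (Spec (.of A))) (j : ∀ n, G₀ n ⟶ B.G n)
    (hjo : ∀ n, IsOpenImmersion (j n).left) (hjc : ∀ n, IsClosedImmersion (j n).left)
    (hunit : ∀ n, letI := B.grpObj n; Set.range (η[B.G n]).left.base ⊆ Set.range (j n).left.base)
    (hlift : ∀ (V : Over (Spec (.of A))) [IsAffine V.left] (V₀ : Scheme.{u}) (ρV : V₀ ⟶ V.left) (bV : V₀ ⟶ Spec (.of (A ⧸ J))),
      IsPullback ρV bV V.hom (Spec.map (CommRingCat.ofHom (Ideal.Quotient.mk J))) →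
      ∀ (n : ℕ) (z₀ : V₀ ⟶ (G₀ n).left), z₀ ≫ (G₀ n).hom = ρV ≫ V.hom →
        ∃ (m : ℕ) (hnm : n ≤ m) (z : V.left ⟶ (G₀ m).left), z ≫ (G₀ m).hom = V.hom ∧
          ρV ≫ z ≫ (j m).left = z₀ ≫ (j n).left ≫ (B.transition hnm).left)
    (T : Over (Spec (.of A))) [IsAffine T.left] (T₀ : Scheme.{u}) (ρ : T₀ ⟶ T.left) (b : T₀ ⟶ Spec (.of (A ⧸ J)))
    (hρ : IsPullback ρ b T.hom (Spec.map (CommRingCat.ofHom (Ideal.Quotient.mk J))))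
    (n : ℕ) (u₀ : T₀ ⟶ (B.G n).left) (hu₀ : u₀ ≫ B.hom n = ρ ≫ T.hom) :
    ∃ (V : Over (Spec (.of A))) (c : V ⟶ T), IsAffine V.left ∧ IsFinite c.left ∧ Flat c.left ∧ Surjective c.left ∧
      ∃ (m : ℕ) (hnm : n ≤ m) (F : V ⟶ B.G m),
        pullback.fst c.left ρ ≫ F.left = pullback.snd c.left ρ ≫ u₀ ≫ (B.transition hnm).left := by
  classical
  letI := B.grpObj n
  haveI : IsFinite (B.G n).hom := B.isFinite n
  haveI : Flat (B.G n).hom := B.flat n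
  haveI : IsAffine (B.G n).left := isAffine_of_isAffineHom (B.G n).hom
  -- `W := T ×_S G` (affine) with projections `π₁` (finite flat) and `τ` (the tautological point)
  let π₁ : T ⊗ B.G n ⟶ T := fst T (B.G n)
  let τ : T ⊗ B.G n ⟶ B.G n := snd T (B.G n)
  have hπ₁ : π₁.left = pullback.fst T.hom (B.G n).hom := rfl
  haveI hWaff : IsAffine (T ⊗ B.G n).left := by
    change IsAffine (pullback T.hom (B.G n).hom); infer_instance
  have hπ₁fin' : IsFinite (pullback.fst T.hom (B.G n).hom) := inferInstance
  have hπ₁fl' : Flat (pullback.fst T.hom (B.G n).hom) := inferInstance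
  haveI hπ₁fin : IsFinite π₁.left := hπ₁fin'
  haveI hπ₁fl : Flat π₁.left := hπ₁fl'
  -- `T₀` over `S`, the point `u₀` as an `S`-morphism
  let T₀' : Over (Spec (.of A)) := Over.mk (ρ ≫ T.hom)
  let U₀pt : T₀' ⟶ B.G n := Over.homMk u₀ hu₀
  -- `P := T₀ ×_T W` (the reduction of `W`): `pr₂ : P → W` is a surjective closed immersion (base change of `ρ`, itself one of `i`)
  let P : Scheme.{u} := pullback ρ π₁.left
  let pr₁ : P ⟶ T₀ := pullback.fst ρ π₁.left
  let pr₂ : P ⟶ (T ⊗ B.G n).left := pullback.snd ρ π₁.left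
  haveI : IsClosedImmersion (Spec.map (CommRingCat.ofHom (Ideal.Quotient.mk J))) :=
    IsClosedImmersion.spec_of_surjective _ Ideal.Quotient.mk_surjective
  haveI hρcl : IsClosedImmersion ρ := MorphismProperty.of_isPullback hρ.flip inferInstance
  haveI hρsurj : Surjective ρ :=
    MorphismProperty.of_isPullback hρ.flip (surjective_specMap_quotient_mk_of_subset_nilradical J hJ)
  haveI hpr₂cl : IsClosedImmersion pr₂ := inferInstance
  haveI hpr₂surj : Surjective pr₂ := inferInstance
  let P' : Over (Spec (.of A)) := Over.mk (pr₂ ≫ (T ⊗ B.G n).hom)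
  have hpr₁w : pr₁ ≫ ρ ≫ T.hom = pr₂ ≫ (T ⊗ B.G n).hom := by
    rw [← Category.assoc, pullback.condition, Category.assoc]
    exact congrArg (pr₂ ≫ ·) (Over.w π₁).symm
  let pr₁' : P' ⟶ T₀' := Over.homMk pr₁ hpr₁w
  let pr₂' : P' ⟶ T ⊗ B.G n := Over.homMk pr₂ rfl
  -- the translated point `y₀ := (u₀ ∘ pr₁) · (τ ∘ pr₂)⁻¹` on `P`
  let y₀ : P' ⟶ B.G n := (pr₁' ≫ U₀pt) * (pr₂' ≫ τ)⁻¹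
  -- the clopen locus `U₀ ⊆ P` where `y₀` lands in the unit component, and its transport `Vop ⊆ W`
  have hjrange : IsClopen (Set.range (j n).left.base) :=
    ⟨(j n).left.isClosedEmbedding.isClosed_range, (j n).left.isOpenEmbedding.isOpen_range⟩
  let U₀set : Set P := y₀.left.base ⁻¹' Set.range (j n).left.base
  have hU₀ : IsClopen U₀set := hjrange.preimage y₀.left.continuous
  obtain ⟨hVclopen, hVpre⟩ := isClopen_image_of_isClosedImmersion_of_surjective pr₂ hU₀
  let Vop : (T ⊗ B.G n).left.Opens := ⟨pr₂.base '' U₀set, hVclopen.2⟩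
  have hVaff : IsAffineOpen Vop := Literature.NumberTheory.EllipticCurves.isAffineOpen_of_isClopen Vop hVclopen
  haveI : IsAffine (Vop : Scheme.{u}) := hVaff
  haveI hVιcl : IsClosedImmersion Vop.ι :=
    IsClosedImmersion.of_isPreimmersion _ (by rw [Scheme.Opens.range_ι]; exact hVclopen.1)
  let V : Over (Spec (.of A)) := Over.mk (Vop.ι ≫ (T ⊗ B.G n).hom)
  let ιV : V ⟶ T ⊗ B.G n := Over.homMk Vop.ι rfl
  let c : V ⟶ T := ιV ≫ π₁
  have hc_left : c.left = Vop.ι ≫ π₁.left := rfl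
  -- the reduction `U₀ = pr₂⁻¹(V)` of `V` as an open subscheme of `P`, with `ρV : U₀ → V` the restriction of `pr₂`
  have hU₀eq : pr₂ ⁻¹ᵁ Vop = ⟨U₀set, hU₀.2⟩ := TopologicalSpace.Opens.ext hVpre
  let U₀ : P.Opens := pr₂ ⁻¹ᵁ Vop
  let ρV : (U₀ : Scheme.{u}) ⟶ (Vop : Scheme.{u}) := pr₂ ∣_ Vop
  have hρVsq : IsPullback ρV U₀.ι Vop.ι pr₂ := isPullback_morphismRestrict pr₂ Vop
  -- the section `s := (𝟙, u₀) : T₀ → P` and surjectivity of `c`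
  have hsurj : Surjective c.left := by
    rw [hc_left]
    -- `σ := (ρ, u₀) : T₀ → W`, `s : T₀ → P`
    let σ : T₀' ⟶ T ⊗ B.G n := lift (Over.homMk ρ rfl : T₀' ⟶ T) U₀pt
    have hσ₁ : σ ≫ π₁ = (Over.homMk ρ rfl : T₀' ⟶ T) := lift_fst _ _
    let s : T₀ ⟶ P := pullback.lift (𝟙 T₀) σ.left (by
      rw [Category.id_comp]; exact (congrArg Over.Hom.left hσ₁).symm)
    have hs₁ : s ≫ pr₁ = 𝟙 T₀ := pullback.lift_fst _ _ _
    have hs₂ : s ≫ pr₂ = σ.left := pullback.lift_snd _ _ _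
    -- `y₀ ∘ s = u₀ · u₀⁻¹ = 1`
    let s' : T₀' ⟶ P' := Over.homMk s (by
      change s ≫ pr₂ ≫ (T ⊗ B.G n).hom = ρ ≫ T.hom
      rw [← Category.assoc, hs₂]
      exact Over.w σ)
    have hs'y : s' ≫ y₀ = 1 := by
      have h1 : s' ≫ pr₁' = 𝟙 T₀' := Over.OverMorphism.ext hs₁
      have h2 : s' ≫ pr₂' = σ := Over.OverMorphism.ext hs₂
      change s' ≫ ((pr₁' ≫ U₀pt) * (pr₂' ≫ τ)⁻¹) = 1
      rw [MonObj.comp_mul, GrpObj.comp_inv, ← Category.assoc, ← Category.assoc, h1, h2, Category.id_comp, lift_snd,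
        mul_inv_cancel]
    have hsU : ∀ t : T₀, s.base t ∈ U₀set := by
      intro t
      have h1' : s ≫ y₀.left = T₀'.hom ≫ (η[B.G n]).left := congrArg Over.Hom.left hs'y
      have h2' := congrArg (fun f : T₀ ⟶ (B.G n).left => f.base t) h1'
      exact hunit n ⟨T₀'.hom.base t, h2'.symm⟩
    have key : s ≫ pr₂ ≫ π₁.left = ρ := by
      rw [← pullback.condition, ← Category.assoc, hs₁, Category.id_comp]
    refine ⟨fun t => ?_⟩
    obtain ⟨t₀, rfl⟩ := ρ.surjective t
    refine ⟨⟨pr₂.base (s.base t₀), ⟨s.base t₀, hsU t₀, rfl⟩⟩, ?_⟩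
    conv_rhs => rw [← key]
    rfl
  have hVaffine : IsAffine V.left := inferInstanceAs (IsAffine (Vop : Scheme.{u}))
  have hcfin : IsFinite c.left := by
    have : IsFinite (Vop.ι ≫ π₁.left) := inferInstance
    exact this
  have hcflat : Flat c.left := by
    have : Flat (Vop.ι ≫ π₁.left) := inferInstance
    exact this
  refine ⟨V, c, hVaffine, hcfin, hcflat, hsurj, ?_⟩
  -- the two pullback squares `P = T₀ ×_T W` (definition) and `P = Spec (A⧸J) ×_S W` (pasting with `hρ`)
  have hPsq₁ : IsPullback pr₂ pr₁ π₁.left ρ := (IsPullback.of_hasPullback ρ π₁.left).flip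
  have hPsq : IsPullback pr₂ (pr₁ ≫ b) (T ⊗ B.G n).hom (Spec.map (CommRingCat.ofHom (Ideal.Quotient.mk J))) := by
    rw [← Over.w π₁]
    exact hPsq₁.paste_vert hρ
  -- the reduction square of `V`, and the square `U₀ = V ×_T T₀`
  have hVsq : IsPullback ρV (U₀.ι ≫ pr₁ ≫ b) V.hom (Spec.map (CommRingCat.ofHom (Ideal.Quotient.mk J))) :=
    hρVsq.paste_vert hPsq
  have hVT : IsPullback ρV (U₀.ι ≫ pr₁) c.left ρ := by
    rw [hc_left]; exact hρVsq.paste_vert hPsq₁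
  -- the point to lift: `y₀ ∣ U₀` factors through the unit component `G₀ n`
  have hrange : Set.range (U₀.ι ≫ y₀.left).base ⊆ Set.range (j n).left.base := by
    rintro _ ⟨x, rfl⟩
    have hx1 : U₀.ι.base x ∈ (pr₂ ⁻¹ᵁ Vop : Set P) := by
      rw [← Scheme.Opens.range_ι (pr₂ ⁻¹ᵁ Vop)]; exact ⟨x, rfl⟩
    rw [hU₀eq] at hx1
    exact hx1
  let z₀ : (U₀ : Scheme.{u}) ⟶ (G₀ n).left := IsOpenImmersion.lift (j n).left (U₀.ι ≫ y₀.left) hrange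
  have hz₀j : z₀ ≫ (j n).left = U₀.ι ≫ y₀.left := IsOpenImmersion.lift_fac _ _ _
  have hz₀ : z₀ ≫ (G₀ n).hom = ρV ≫ V.hom := by
    have w1 : (j n).left ≫ (B.G n).hom = (G₀ n).hom := Over.w (j n)
    have w2 : U₀.ι ≫ y₀.left ≫ (B.G n).hom = U₀.ι ≫ pr₂ ≫ (T ⊗ B.G n).hom := congrArg (U₀.ι ≫ ·) (Over.w y₀)
    have w3 : ρV ≫ Vop.ι = U₀.ι ≫ pr₂ := hρVsq.w
    calc z₀ ≫ (G₀ n).hom = z₀ ≫ (j n).left ≫ (B.G n).hom := by rw [w1]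
      _ = (z₀ ≫ (j n).left) ≫ (B.G n).hom := (Category.assoc _ _ _).symm
      _ = (U₀.ι ≫ y₀.left) ≫ (B.G n).hom := by rw [hz₀j]
      _ = U₀.ι ≫ pr₂ ≫ (T ⊗ B.G n).hom := by rw [Category.assoc]; exact w2
      _ = (ρV ≫ Vop.ι) ≫ (T ⊗ B.G n).hom := by rw [w3, Category.assoc]
      _ = ρV ≫ V.hom := Category.assoc _ _ _
  obtain ⟨m, hnm, z, hz, hzz⟩ := hlift V ↑U₀ ρV (U₀.ι ≫ pr₁ ≫ b) hVsq n z₀ hz₀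
  letI := B.grpObj m
  haveI : IsMonHom (B.transition hnm) := B.isMonHom_transition hnm
  -- the lift `F := (j z) · (τ ∣_V)` on `V`
  let Zpt : V ⟶ B.G m := Over.homMk (z ≫ (j m).left) (by rw [Category.assoc, Over.w (j m), hz])
  let τV : V ⟶ B.G m := ιV ≫ τ ≫ B.transition hnm
  refine ⟨m, hnm, Zpt * τV, ?_⟩
  -- KEY: on `U₀`, `F` restricts to `(y₀ · τ) ∣ U₀ ≫ transition = u₀ ∘ pr₁ ≫ transition`
  let V₀' : Over (Spec (.of A)) := Over.mk (ρV ≫ V.hom)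
  let ρV' : V₀' ⟶ V := Over.homMk ρV rfl
  let k : V₀' ⟶ P' := Over.homMk U₀.ι (by
    change U₀.ι ≫ pr₂ ≫ (T ⊗ B.G n).hom = ρV ≫ Vop.ι ≫ (T ⊗ B.G n).hom
    rw [← Category.assoc, ← hρVsq.w, Category.assoc])
  have hk₁ : ρV' ≫ Zpt = k ≫ y₀ ≫ B.transition hnm := by
    apply Over.OverMorphism.ext
    change ρV ≫ z ≫ (j m).left = U₀.ι ≫ y₀.left ≫ (B.transition hnm).left
    have h3 : (z₀ ≫ (j n).left) ≫ (B.transition hnm).left = (U₀.ι ≫ y₀.left) ≫ (B.transition hnm).left :=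
      congrArg (· ≫ (B.transition hnm).left) hz₀j
    rw [Category.assoc, Category.assoc] at h3
    exact hzz.trans h3
  have hk₂ : ρV' ≫ ιV = k ≫ pr₂' := by
    apply Over.OverMorphism.ext
    change ρV ≫ Vop.ι = U₀.ι ≫ pr₂
    exact hρVsq.w
  have hτV' : ρV' ≫ τV = k ≫ ((pr₂' ≫ τ) ≫ B.transition hnm) := by
    change ρV' ≫ ιV ≫ τ ≫ B.transition hnm = _
    rw [← Category.assoc, hk₂, Category.assoc, Category.assoc]
  have hy : y₀ * (pr₂' ≫ τ) = pr₁' ≫ U₀pt := by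
    change ((pr₁' ≫ U₀pt) * (pr₂' ≫ τ)⁻¹) * (pr₂' ≫ τ) = pr₁' ≫ U₀pt
    rw [inv_mul_cancel_right]
  have hKEY : ρV' ≫ (Zpt * τV) = k ≫ (pr₁' ≫ U₀pt) ≫ B.transition hnm := by
    calc ρV' ≫ (Zpt * τV) = (ρV' ≫ Zpt) * (ρV' ≫ τV) := MonObj.comp_mul _ _ _
      _ = (k ≫ (y₀ ≫ B.transition hnm)) * (k ≫ ((pr₂' ≫ τ) ≫ B.transition hnm)) := by rw [hk₁, hτV']
      _ = k ≫ ((y₀ ≫ B.transition hnm) * ((pr₂' ≫ τ) ≫ B.transition hnm)) := (MonObj.comp_mul _ _ _).symm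
      _ = k ≫ ((y₀ * (pr₂' ≫ τ)) ≫ B.transition hnm) :=
          congrArg (k ≫ ·) (MonObj.mul_comp y₀ (pr₂' ≫ τ) (B.transition hnm)).symm
      _ = k ≫ (pr₁' ≫ U₀pt) ≫ B.transition hnm := by rw [hy]
  have hKEYleft : ρV ≫ (Zpt * τV).left = U₀.ι ≫ pr₁ ≫ u₀ ≫ (B.transition hnm).left := by
    have := congrArg Over.Hom.left hKEY
    simp only [Over.comp_left, Category.assoc] at this
    exact this
  -- transport to ANY cone over the square `V ×_T T₀` (in particular Mathlib's chosen `pullback c ρ`)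
  suffices H : ∀ (Q : Scheme.{u}) (q₁ : Q ⟶ V.left) (q₂ : Q ⟶ T₀) (w : q₁ ≫ c.left = q₂ ≫ ρ),
      q₁ ≫ (Zpt * τV).left = q₂ ≫ u₀ ≫ (B.transition hnm).left from H _ _ _ pullback.condition
  intro Q q₁ q₂ w
  have h1 : hVT.lift q₁ q₂ w ≫ ρV = q₁ := hVT.lift_fst _ _ _
  have h2 : hVT.lift q₁ q₂ w ≫ (U₀.ι ≫ pr₁) = q₂ := hVT.lift_snd _ _ _
  calc q₁ ≫ (Zpt * τV).left = (hVT.lift q₁ q₂ w ≫ ρV) ≫ (Zpt * τV).left := congrArg (· ≫ (Zpt * τV).left) h1.symm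
    _ = hVT.lift q₁ q₂ w ≫ ρV ≫ (Zpt * τV).left := Category.assoc _ _ _
    _ = hVT.lift q₁ q₂ w ≫ U₀.ι ≫ pr₁ ≫ u₀ ≫ (B.transition hnm).left := by rw [hKEYleft]
    _ = (hVT.lift q₁ q₂ w ≫ U₀.ι ≫ pr₁) ≫ u₀ ≫ (B.transition hnm).left := by simp only [Category.assoc]
    _ = q₂ ≫ u₀ ≫ (B.transition hnm).left := by rw [h2]

end BTGroup

end Literature.AlgebraicGeometry.GroupSchemes

end
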